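import Mathlib.Analysis.InnerProductSpace.PiL2
import Mathlib.Analysis.Calculus.ContDiff.Operations
import Mathlib.Analysis.Calculus.ContDiff.Comp
import Mathlib.Analysis.Calculus.FDeriv.CompCLM
import Mathlib.Topology.MetricSpace.Holder
import Mathlib.Logic.Equiv.Fin.Rotate
import Literature.Analysis.Calculus.IteratedFDerivSymmetric
import HarnessLib

/-!
# Coordinate jets of all orders of a real function in an orthonormal basis

Calculus layer (everything proved, no named facts) of the a-priori bootstrap of
Gilbarg–Trudinger (2001), Lemma 17.16: uniform `C^{2,α}` chart bounds for solutions of a smooth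
fully nonlinear uniformly elliptic equation `G(y, θ, u, Du, D²u) = 0` give uniform `C^m` bounds
for every `m`.  This is the bootstrap behind the closedness half of the Gursky–Viaclovsky
continuity method (`Literature.Geometry.Riemannian.gurskyViaclovsky_pathClosed_weighted_four`).
The bootstrap differentiates the equation again and again along coordinate directions; to do
this uniformly in the order we package all derivatives of `u` at a point into **coordinate jets**.

* `CJet ι m = Π (j : Fin (m+1)), (Fin j → ι) → ℝ`: arrays `(J₀, …, J_m)`, the entry `J_j I`
  standing for the component `Dʲu(y)(e_{I 0}, …, e_{I (j-1)})`.  A finite-dimensional real normed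
  space (sup norm of sup norms), so Mathlib's `fderiv`/`ContDiff` calculus applies to functions
  of jets.
* `cjetOf bE m u y`: the coordinate `m`-jet of `u : E → ℝ` at `y` in the orthonormal basis `bE`.
* `CJet.trunc` forgets the top slot; `CJet.ins i₀` is `(ins i₀ J)_j I = J_{j+1} (snoc I i₀)`: the
  new direction goes into the LAST slot.  Mathlib's `fderiv_iteratedFDeriv` /
  `iteratedFDeriv_succ_apply_left` put it into the first slot; for `C^{j+1}` functions the two
  agree by the symmetry of higher derivatives (`iteratedFDeriv_apply_perm_of_le` of
  `Literature/Analysis/Calculus/IteratedFDerivSymmetric.lean` with the permutation `finRotate`,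
  `Fin.snoc_eq_cons_rotate`).  With this convention `trunc (cjetOf (m+1) u y) = cjetOf m u y`
  holds by `rfl` and `∂_{e_{i₀}} (cjetOf m u) (y) = ins i₀ (cjetOf (m+1) u y)`
  (`hasFDerivAt_cjetOf_apply`).
* `CJet.trunc_single_last`, `CJet.ins_single_last`: how `trunc`/`ins` act on a jet supported in
  the top slot (used for the principal symbol of differentiated equations).
* Bounds: `abs_cjetOf_le`, `norm_cjetOf_le`, `holderOnWith_cjetOf` (the jet map is bounded, resp.
  Hölder, where the `Dʲu` are) and smoothness `contDiffOn_cjetOf`.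
* Level two: `pOf`, `rOf` read off the covector `Du(y)` and the bilinear form `D²u(y)` from a
  `2`-jet (`pOf_cjetOf`, `rOf_cjetOf`); they are continuous linear in the jet, vanish resp. are
  rank one on jets supported in the top slot (`pOf_single_last`, `rOf_single_sq`), which is what
  enters the ellipticity condition of the differentiated equations.

The total derivative of a function of `(y, θ, jet)` along a basis direction and the chain rule
along coordinate jets are in `Literature/Analysis/Calculus/CoordinateJetsTD.lean`.  Not here:
anything about elliptic equations (this file is pure calculus).

## References

* D. Gilbarg, N. S. Trudinger, *Elliptic Partial Differential Equations of Second Order*,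
  Classics in Mathematics, Springer 2001, Lemma 17.16. [GilbargTrudinger2001]
* J. Dieudonné, *Foundations of Modern Analysis*, Academic Press 1960, Ch. VIII §12 (symmetry of
  higher derivatives). [Dieudonne1960]
-/

noncomputable section

open scoped ContDiff Topology
open Set Function

namespace Literature.Analysis.Calculus

/-- **Coordinate `m`-jets**: arrays `(J₀, …, J_m)`, `J_j : (Fin j → ι) → ℝ` (the components
`Dʲu(y)(e_{I₁}, …, e_{I_j})` of the derivatives in a basis indexed by `ι`). A finite-dimensional
real normed space (sup norms). [folklore] -/
abbrev CJet (ι : Type*) (m : ℕ) : Type _ := (j : Fin (m + 1)) → (Fin (j : ℕ) → ι) → ℝ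

variable {ι : Type*} [Fintype ι] {E : Type*} [NormedAddCommGroup E] [InnerProductSpace ℝ E]

/-- The coordinate `m`-jet of `u` at `y` in the orthonormal basis `e`:
`(j, I) ↦ Dʲu(y)(e_{I₁}, …, e_{I_j})`. [folklore] -/
def cjetOf (bE : OrthonormalBasis ι ℝ E) (m : ℕ) (u : E → ℝ) (y : E) : CJet ι m :=
  fun j I => iteratedFDeriv ℝ (j : ℕ) u y (fun k => bE (I k))

/-- Components of the coordinate jet (definitional unfolding). [folklore] -/
@[simp] theorem cjetOf_apply (bE : OrthonormalBasis ι ℝ E) (m : ℕ) (u : E → ℝ) (y : E)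
    (j : Fin (m + 1)) (I : Fin (j : ℕ) → ι) :
    cjetOf bE m u y j I = iteratedFDeriv ℝ (j : ℕ) u y (fun k => bE (I k)) := rfl

namespace CJet

variable (ι)

/-- Truncation `(J₀, …, J_{m+1}) ↦ (J₀, …, J_m)`. [folklore] -/
def trunc (m : ℕ) : CJet ι (m + 1) →L[ℝ] CJet ι m :=
  ContinuousLinearMap.pi fun j : Fin (m + 1) =>
    (ContinuousLinearMap.proj (R := ℝ) (φ := fun i : Fin (m + 2) => (Fin (i : ℕ) → ι) → ℝ)
      (Fin.castSucc j))

/-- Insertion of the basis direction `i₀` in the LAST slot, shifting down: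
`(ins i₀ J)_j (I) = J_{j+1} (I, i₀)`. [folklore] -/
def ins (m : ℕ) (i₀ : ι) : CJet ι (m + 1) →L[ℝ] CJet ι m :=
  ContinuousLinearMap.pi fun j : Fin (m + 1) =>
    (ContinuousLinearMap.pi fun I : Fin (j : ℕ) → ι =>
        (ContinuousLinearMap.proj (R := ℝ) (φ := fun _ : (Fin ((j : ℕ) + 1) → ι) => ℝ)
          (Fin.snoc I i₀))).comp
      (ContinuousLinearMap.proj (R := ℝ) (φ := fun i : Fin (m + 2) => (Fin (i : ℕ) → ι) → ℝ)
        (Fin.succ j))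

variable {ι}

omit [Fintype ι] in
/-- `trunc` drops the top slot: `(trunc J)_j = J_j` for `j ≤ m`. [folklore] -/
@[simp] theorem trunc_apply (m : ℕ) (J : CJet ι (m + 1)) (j : Fin (m + 1))
    (I : Fin (j : ℕ) → ι) : trunc ι m J j I = J (Fin.castSucc j) I := rfl

omit [Fintype ι] in
/-- `(ins i₀ J)_j (I) = J_{j+1} (snoc I i₀)`. [folklore] -/
@[simp] theorem ins_apply (m : ℕ) (i₀ : ι) (J : CJet ι (m + 1)) (j : Fin (m + 1))
    (I : Fin (j : ℕ) → ι) :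
    ins ι m i₀ J j I = J (Fin.succ j) (Fin.snoc I i₀) := rfl

/-- Truncating the `(m+1)`-jet of `u` gives its `m`-jet, definitionally. [folklore] -/
theorem trunc_cjetOf (bE : OrthonormalBasis ι ℝ E) (m : ℕ) (u : E → ℝ) (y : E) :
    trunc ι m (cjetOf bE (m + 1) u y) = cjetOf bE m u y := rfl

omit [Fintype ι] in
/-- A jet supported in the top slot truncates to zero. [folklore] -/
theorem trunc_single_last (m : ℕ) (Ω : (Fin (m + 1) → ι) → ℝ) :
    trunc ι m (Pi.single (Fin.last (m + 1)) Ω) = 0 := by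
  funext j I
  rw [trunc_apply, Pi.single_eq_of_ne (Fin.castSucc_lt_last j).ne]
  rfl

omit [Fintype ι] in
/-- Inserting a direction into a jet supported in the top slot `m+1` gives the jet supported in
the top slot `m` with entries `I ↦ Ω (snoc I i₀)`. [folklore] -/
theorem ins_single_last (m : ℕ) (i₀ : ι) (Ω : (Fin (m + 1) → ι) → ℝ) :
    ins ι m i₀ (Pi.single (Fin.last (m + 1)) Ω) =
      Pi.single (Fin.last m) (fun I : Fin m → ι => Ω (Fin.snoc I i₀)) := by
  funext j I
  rw [ins_apply]
  by_cases hj : j = Fin.last m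
  · subst hj
    rw [Pi.single_eq_same]
    show (Pi.single (Fin.last (m + 1)) Ω : CJet ι (m + 1)) (Fin.last (m + 1)) (Fin.snoc I i₀) = _
    rw [Pi.single_eq_same]
    rfl
  · have hj' : Fin.succ j ≠ Fin.last (m + 1) := fun h => hj (Fin.succ_eq_last_succ.1 h)
    rw [Pi.single_eq_of_ne hj', Pi.single_eq_of_ne hj]
    rfl

end CJet

/-- **Derivative of the coordinate jet map** along a basis direction: for `u` of class
`C^{m+1}` at `y`, `∂_{e_{i₀}} cjet_m u (y) = ins i₀ (cjet_{m+1} u (y))` (Mathlib's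
`fderiv_iteratedFDeriv` — the new direction enters in the first slot — and the symmetry of
`D^{j+1}u(y)`, `Fin.snoc_eq_cons_rotate`). [folklore] -/
theorem hasFDerivAt_cjetOf_apply (bE : OrthonormalBasis ι ℝ E) {m : ℕ} {u : E → ℝ} {y : E}
    (hu : ContDiffAt ℝ (m + 1 : ℕ) u y) :
    DifferentiableAt ℝ (cjetOf bE m u) y ∧
      ∀ i₀, fderiv ℝ (cjetOf bE m u) y (bE i₀) = CJet.ins ι m i₀ (cjetOf bE (m + 1) u y) := by
  -- each component `z ↦ Dʲu(z)(e_I)` is `(evaluation at e_I) ∘ Dʲu`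
  have hcomp : ∀ (j : Fin (m + 1)) (I : Fin (j : ℕ) → ι),
      HasFDerivAt (fun z => cjetOf bE m u z j I)
        ((fderiv ℝ (iteratedFDeriv ℝ (j : ℕ) u) y).flipMultilinear (fun k => bE (I k))) y :=
    fun j I =>
      (hu.differentiableAt_iteratedFDeriv
        (by exact_mod_cast j.isLt)).hasFDerivAt.continuousMultilinear_apply_const _
  have hd : DifferentiableAt ℝ (cjetOf bE m u) y :=
    differentiableAt_pi.2 fun j => differentiableAt_pi.2 fun I => (hcomp j I).differentiableAt
  refine ⟨hd, fun i₀ => ?_⟩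
  funext j I
  have h1 : HasFDerivAt (fun z => cjetOf bE m u z j I)
      ((ContinuousLinearMap.proj I).comp
        ((ContinuousLinearMap.proj j).comp (fderiv ℝ (cjetOf bE m u) y))) y :=
    hasFDerivAt_pi'.1 (hasFDerivAt_pi'.1 hd.hasFDerivAt j) I
  have h2 := congrArg (fun L : E →L[ℝ] ℝ => L (bE i₀)) ((hcomp j I).unique h1)
  simp only [ContinuousLinearMap.comp_apply, ContinuousLinearMap.proj_apply,
    ContinuousLinearMap.flipMultilinear_apply_apply] at h2
  rw [← h2, CJet.ins_apply, cjetOf_apply]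
  -- `D(Dʲu)(y)(e_{i₀})(e_I) = D^{j+1}u(y)(cons e_{i₀} e_I) = D^{j+1}u(y)(snoc e_I e_{i₀})`
  have hs : (fun k : Fin ((j : ℕ) + 1) => bE (Fin.snoc (α := fun _ => ι) I i₀ k)) =
      Fin.snoc (α := fun _ => E) (fun k => bE (I k)) (bE i₀) := Fin.comp_snoc bE I i₀
  have hle : (((j : ℕ) + 1 : ℕ) : WithTop ℕ∞) ≤ ((m + 1 : ℕ) : WithTop ℕ∞) := by
    exact_mod_cast Nat.succ_le_of_lt j.isLt
  show _ = iteratedFDeriv ℝ ((j : ℕ) + 1) u y (fun k => bE (Fin.snoc (α := fun _ => ι) I i₀ k))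
  rw [hs, Fin.snoc_eq_cons_rotate, iteratedFDeriv_apply_perm_of_le hu hle,
    iteratedFDeriv_succ_apply_left, Fin.cons_zero, Fin.tail_cons]

/-- The coordinate jet map of a `C^∞` function is `C^∞` on the open set. [folklore] -/
theorem contDiffOn_cjetOf (bE : OrthonormalBasis ι ℝ E) (m : ℕ) {u : E → ℝ} {O : Set E}
    (hO : IsOpen O) (hu : ContDiffOn ℝ ∞ u O) : ContDiffOn ℝ ∞ (cjetOf bE m u) O := by
  refine contDiffOn_pi.2 fun j => contDiffOn_pi.2 fun I => fun y hy => ?_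
  have hinf : (∞ : WithTop ℕ∞) + ((j : ℕ) : WithTop ℕ∞) ≤ ∞ := by
    rw [← WithTop.coe_natCast, ← WithTop.coe_add, top_add]
  have h1 : ContDiffAt ℝ ∞ (iteratedFDeriv ℝ (j : ℕ) u) y :=
    (hu.contDiffAt (hO.mem_nhds hy)).iteratedFDeriv_right hinf
  exact ((ContinuousMultilinearMap.apply ℝ (fun _ : Fin (j : ℕ) => E) ℝ
    (fun k => bE (I k))).contDiff.contDiffAt.comp y h1).contDiffWithinAt

/-- Components are bounded by operator norms: `|cjet_m u(y)_j(I)| ≤ ‖Dʲu(y)‖` (the basis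
vectors have norm one). [folklore] -/
theorem abs_cjetOf_le (bE : OrthonormalBasis ι ℝ E) (m : ℕ) (u : E → ℝ) (y : E)
    (j : Fin (m + 1)) (I : Fin (j : ℕ) → ι) :
    |cjetOf bE m u y j I| ≤ ‖iteratedFDeriv ℝ (j : ℕ) u y‖ := by
  rw [← Real.norm_eq_abs, cjetOf_apply]
  refine ((iteratedFDeriv ℝ (j : ℕ) u y).le_opNorm _).trans ?_
  rw [Finset.prod_eq_one (fun k _ => bE.orthonormal.1 (I k)), mul_one]

/-- The jet map is bounded on a set when the derivatives are: `‖Dʲu(y)‖ ≤ B` for all `j ≤ m`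
gives `‖cjet_m u(y)‖ ≤ B` (sup norm). [folklore] -/
theorem norm_cjetOf_le (bE : OrthonormalBasis ι ℝ E) (m : ℕ) (u : E → ℝ) (y : E) {B : ℝ}
    (hB : ∀ j ≤ m, ‖iteratedFDeriv ℝ j u y‖ ≤ B) (hB0 : 0 ≤ B) : ‖cjetOf bE m u y‖ ≤ B := by
  refine (pi_norm_le_iff_of_nonneg hB0).2 fun j => (pi_norm_le_iff_of_nonneg hB0).2 fun I => ?_
  rw [Real.norm_eq_abs]
  exact (abs_cjetOf_le bE m u y j I).trans (hB j (Fin.is_le j))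

/-- The jet map is Hölder on a set when the derivatives `Dʲu`, `j ≤ m`, are (same constant and
exponent; the sup edistance on the jet space is the sup over the components, each of which is an
evaluation of `Dʲu` at unit vectors). [folklore] -/
theorem holderOnWith_cjetOf (bE : OrthonormalBasis ι ℝ E) (m : ℕ) (u : E → ℝ) {s : Set E}
    {C r : NNReal} (hC : ∀ j ≤ m, HolderOnWith C r (iteratedFDeriv ℝ j u) s) :
    HolderOnWith C r (cjetOf bE m u) s := by
  intro x hx y hy
  refine edist_pi_le_iff.2 fun j => edist_pi_le_iff.2 fun I => ?_
  refine le_trans ?_ (hC j (Fin.is_le j) x hx y hy)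
  simp only [cjetOf_apply, edist_dist, dist_eq_norm]
  apply ENNReal.ofReal_le_ofReal
  rw [← sub_apply]
  refine (ContinuousMultilinearMap.le_opNorm _ _).trans ?_
  rw [Finset.prod_eq_one (fun k _ => bE.orthonormal.1 (I k)), mul_one]

section LevelTwo

/-! ### Level two: the covector and the bilinear form of a `2`-jet -/

/-- The covector of a `2`-jet's first-order part: `Σ_i J₁(i) e_i^♭`. [folklore] -/
def pOf (bE : OrthonormalBasis ι ℝ E) (J : CJet ι 2) : E →L[ℝ] ℝ :=
  ∑ i, J 1 (fun _ => i) • innerSL ℝ (bE i)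

/-- The bilinear form of a `2`-jet's second-order part: `Σ_{ij} J₂(i,j) e_i^♭ ⊗ e_j^♭`.
[folklore] -/
def rOf (bE : OrthonormalBasis ι ℝ E) (J : CJet ι 2) : E →L[ℝ] E →L[ℝ] ℝ :=
  ∑ i, ∑ j, J 2 ![i, j] • (innerSL ℝ (bE i)).smulRight (innerSL ℝ (bE j))

/-- `pOf` of the `2`-jet of `u` at `y` is `Du(y)`: `Σ_i Du(y)(e_i) ⟨e_i, v⟩ = Du(y)(v)` by
expanding `v` in the orthonormal basis. [folklore] -/
theorem pOf_cjetOf (bE : OrthonormalBasis ι ℝ E) {u : E → ℝ} {y : E} :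
    pOf bE (cjetOf bE 2 u y) = fderiv ℝ u y := by
  have h1 : ∀ i, cjetOf bE 2 u y 1 (fun _ => i) = fderiv ℝ u y (bE i) := fun i =>
    iteratedFDeriv_one_apply (𝕜 := ℝ) (f := u) (x := y) (fun _ => bE i)
  ext v
  simp only [pOf, h1, FunLike.coe_sum, Finset.sum_apply, FunLike.coe_smul, Pi.smul_apply,
    innerSL_apply_apply, smul_eq_mul]
  conv_rhs => rw [← bE.sum_repr' v, map_sum]
  refine Finset.sum_congr rfl fun i _ => ?_
  rw [map_smul, smul_eq_mul, mul_comm]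

/-- `rOf` of the `2`-jet of `u` at `y` is `D²u(y)` (as `fderiv ℝ (fderiv ℝ u) y`): expand both
arguments in the orthonormal basis (`iteratedFDeriv_two_apply`).  The smoothness hypothesis is not
used in the proof (both sides are built from `fderiv ℝ (fderiv ℝ u) y`, junk values included); it
is kept because this is the intended range of validity. [folklore] -/
theorem rOf_cjetOf (bE : OrthonormalBasis ι ℝ E) {u : E → ℝ} {y : E}
    (_hu : ContDiffAt ℝ 2 u y) : rOf bE (cjetOf bE 2 u y) = fderiv ℝ (fderiv ℝ u) y := by
  have h2 : ∀ i j, cjetOf bE 2 u y 2 ![i, j] = fderiv ℝ (fderiv ℝ u) y (bE i) (bE j) :=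
    fun i j => (iteratedFDeriv_two_apply (𝕜 := ℝ) u y (fun k => bE (![i, j] k))).trans (by simp)
  ext v w
  simp only [rOf, h2, FunLike.coe_sum, Finset.sum_apply, FunLike.coe_smul, Pi.smul_apply,
    ContinuousLinearMap.smulRight_apply, innerSL_apply_apply, smul_eq_mul]
  conv_rhs => rw [← bE.sum_repr' v, ← bE.sum_repr' w, map_sum]
  simp only [map_smul, FunLike.coe_sum, Finset.sum_apply, FunLike.coe_smul, Pi.smul_apply,
    map_sum, smul_eq_mul, Finset.mul_sum]
  rw [Finset.sum_comm]
  refine Finset.sum_congr rfl fun i _ => Finset.sum_congr rfl fun j _ => ?_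
  ring

/-- The order-zero entry of the coordinate jet is the value `u(y)`. [folklore] -/
theorem cjetOf_zero (bE : OrthonormalBasis ι ℝ E) (m : ℕ) (u : E → ℝ) (y : E) (I : Fin 0 → ι) :
    cjetOf bE m u y 0 I = u y :=
  iteratedFDeriv_zero_apply (𝕜 := ℝ) (f := u) (x := y) _

/-- `pOf` is continuous linear in the jet (a finite sum of coordinate functionals times fixed
covectors). [folklore] -/
theorem isBoundedLinearMap_pOf (bE : OrthonormalBasis ι ℝ E) :
    IsBoundedLinearMap ℝ (pOf bE : CJet ι 2 → E →L[ℝ] ℝ) := by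
  refine IsLinearMap.with_bound ⟨fun J K => ?_, fun c J => ?_⟩ (∑ i, ‖innerSL ℝ (bE i)‖)
    fun J => ?_
  · simp only [pOf, Pi.add_apply, add_smul, Finset.sum_add_distrib]
  · simp only [pOf, Pi.smul_apply, smul_eq_mul, mul_smul, Finset.smul_sum]
  · rw [pOf, Finset.sum_mul]
    refine (norm_sum_le _ _).trans (Finset.sum_le_sum fun i _ => ?_)
    rw [norm_smul, mul_comm]
    exact mul_le_mul_of_nonneg_left ((norm_le_pi_norm (J 1) _).trans (norm_le_pi_norm J 1))
      (norm_nonneg _)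

/-- `rOf` is continuous linear in the jet (a finite sum of coordinate functionals times fixed
bilinear forms; the bound is checked on vectors, `|⟨e_i, v⟩| ≤ ‖v‖`). [folklore] -/
theorem isBoundedLinearMap_rOf (bE : OrthonormalBasis ι ℝ E) :
    IsBoundedLinearMap ℝ (rOf bE : CJet ι 2 → E →L[ℝ] E →L[ℝ] ℝ) := by
  refine IsLinearMap.with_bound
    (@IsLinearMap.mk ℝ (CJet ι 2) (E →L[ℝ] E →L[ℝ] ℝ) _ (_) (_) (_) (_) (rOf bE)
      (fun J K => ?_) (fun c J => ?_))
    ((Fintype.card ι : ℝ) ^ 2) fun J => ?_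
  · ext v w
    simp only [rOf, Pi.add_apply, add_apply, FunLike.coe_sum, Finset.sum_apply,
      FunLike.coe_smul, Pi.smul_apply, smul_eq_mul, add_mul, Finset.sum_add_distrib]
  · ext v w
    simp only [rOf, Pi.smul_apply, smul_apply, FunLike.coe_sum, Finset.sum_apply,
      FunLike.coe_smul, smul_eq_mul, mul_assoc, Finset.mul_sum]
  · refine ContinuousLinearMap.opNorm_le_bound _ (by positivity) fun v => ?_
    refine ContinuousLinearMap.opNorm_le_bound _ (by positivity) fun w => ?_
    simp only [rOf, FunLike.coe_sum, Finset.sum_apply, FunLike.coe_smul, Pi.smul_apply,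
      ContinuousLinearMap.smulRight_apply, innerSL_apply_apply, smul_eq_mul, Real.norm_eq_abs]
    have hin : ∀ (i : ι) (x : E), |inner ℝ (bE i) x| ≤ ‖x‖ := fun i x =>
      (abs_real_inner_le_norm _ _).trans_eq (by rw [bE.orthonormal.1 i, one_mul])
    have hJ : ∀ i j, |J 2 ![i, j]| ≤ ‖J‖ := fun i j =>
      (Real.norm_eq_abs _).symm.trans_le ((norm_le_pi_norm (J 2) _).trans (norm_le_pi_norm J 2))
    calc |∑ i, ∑ j, J 2 ![i, j] * (inner ℝ (bE i) v * inner ℝ (bE j) w)|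
        ≤ ∑ i, ∑ j, |J 2 ![i, j] * (inner ℝ (bE i) v * inner ℝ (bE j) w)| :=
          (Finset.abs_sum_le_sum_abs _ _).trans
            (Finset.sum_le_sum fun i _ => Finset.abs_sum_le_sum_abs _ _)
      _ ≤ ∑ _i : ι, ∑ _j : ι, ‖J‖ * (‖v‖ * ‖w‖) :=
          Finset.sum_le_sum fun i _ => Finset.sum_le_sum fun j _ => by
            rw [abs_mul, abs_mul]
            exact mul_le_mul (hJ i j) (mul_le_mul (hin i v) (hin j w) (abs_nonneg _)
              (norm_nonneg _)) (by positivity) (norm_nonneg _)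
      _ = (Fintype.card ι : ℝ) ^ 2 * ‖J‖ * ‖v‖ * ‖w‖ := by
          simp only [Finset.sum_const, Finset.card_univ, nsmul_eq_mul]
          ring

/-- The rank-one direction: `rOf (single₂ (I ↦ η(e_{I₀}) η(e_{I₁}))) = η ⊗ η`. [folklore] -/
theorem rOf_single_sq [DecidableEq ι] (bE : OrthonormalBasis ι ℝ E) (η : E →L[ℝ] ℝ) :
    rOf bE (Pi.single (Fin.last 2) (fun I : Fin 2 → ι => η (bE (I 0)) * η (bE (I 1)))) =
      η.smulRight η := by
  have h2 : ∀ i j, (Pi.single (Fin.last 2) (fun I : Fin 2 → ι => η (bE (I 0)) * η (bE (I 1))) :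
      CJet ι 2) 2 ![i, j] = η (bE i) * η (bE j) := fun i j => by
    show (Pi.single (Fin.last 2) (fun I : Fin 2 → ι => η (bE (I 0)) * η (bE (I 1))) :
      CJet ι 2) (Fin.last 2) ![i, j] = _
    rw [Pi.single_eq_same]
    simp
  ext v w
  simp only [rOf, h2, FunLike.coe_sum, Finset.sum_apply, FunLike.coe_smul, Pi.smul_apply,
    ContinuousLinearMap.smulRight_apply, innerSL_apply_apply, smul_eq_mul]
  conv_rhs => rw [← bE.sum_repr' v, ← bE.sum_repr' w]
  simp only [map_sum, map_smul, smul_eq_mul, Finset.sum_mul_sum]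
  refine Finset.sum_congr rfl fun i _ => Finset.sum_congr rfl fun j _ => ?_
  ring

/-- `pOf` only sees the slot `1`: it vanishes on jets supported in the top slot. [folklore] -/
theorem pOf_single_last [DecidableEq ι] (bE : OrthonormalBasis ι ℝ E) (Ω : (Fin 2 → ι) → ℝ) :
    pOf bE (Pi.single (Fin.last 2) Ω) = 0 := by
  have h1 : ∀ i, (Pi.single (Fin.last 2) Ω : CJet ι 2) 1 (fun _ => i) = 0 := fun i => by
    rw [show (Pi.single (Fin.last 2) Ω : CJet ι 2) 1 = 0 from Pi.single_eq_of_ne (by decide) _]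
    rfl
  simp only [pOf, h1, zero_smul, Finset.sum_const_zero]

end LevelTwo

/-- The jet spaces are finite-dimensional (so linear maps out of them are automatically
continuous, closed balls are compact, etc.). -/
example (m : ℕ) : FiniteDimensional ℝ (CJet ι m) := inferInstance

end Literature.Analysis.Calculus
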